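import Summits.KontsevichZagierPeriods.Zeta5Search.Certificates.RecordRayDenominatorsBricksLaw
import HarnessLib

/-!
# ζ(5) search — the record ray's DENOMINATORS, XII (L16, table part): the last P8 chunk with the law-M window (p3 g5)

HONEST FRAMING: systematic search; no irrationality claim unless certified.

OUR work (Summit side; prover seat p3, generation 5).  The 20 windows of `bwinsP8_32` (θ ∈ (12, 41]) with ONE row changed:
`(15n, 16n]` now has exponent `4` from source kind `2` (law M, `Cell1516.recordCell1516` through `wLaw1516`, file XI-c) instead
of `3` (atlas33 window 26, the `(WV)`-law).  Checked by `BWin.ok2` (`decide`).  Table data only; no irrationality content.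
-/

namespace Summit.KontsevichZagierPeriods.Zeta5Search.RecordRay.BrickAtlas

/-- The last chunk of the `θ > 1/16` atlas with the law-M window `(15n,16n]⁴` (was `³`). -/
def bwinsL16_last : List BWin :=
  [⟨25, 3, 17, 2, 6, 0, 19, 0⟩,
   ⟨17, 2, 9, 1, 5, 0, 22, 0⟩,
   ⟨9, 1, 28, 3, 6, 1, 18, 0⟩,
   ⟨28, 3, 19, 2, 6, 1, 17, 0⟩,
   ⟨19, 2, 29, 3, 6, 1, 16, 0⟩,
   ⟨29, 3, 10, 1, 6, 1, 15, 0⟩,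
   ⟨10, 1, 41, 4, 8, 1, 14, 0⟩,
   ⟨41, 4, 11, 1, 8, 1, 13, 0⟩,
   ⟨11, 1, 12, 1, 10, 1, 12, 0⟩,
   ⟨12, 1, 25, 2, 9, 0, 20, 0⟩,
   ⟨25, 2, 13, 1, 8, 1, 10, 0⟩,
   ⟨13, 1, 27, 2, 6, 1, 9, 0⟩,
   ⟨27, 2, 41, 3, 6, 1, 8, 0⟩,
   ⟨41, 3, 14, 1, 6, 1, 7, 0⟩,
   ⟨14, 1, 15, 1, 3, 0, 21, 0⟩,
   ⟨15, 1, 16, 1, 4, 2, 0, 0⟩,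
   ⟨16, 1, 17, 1, 8, 0, 0, 0⟩,
   ⟨17, 1, 18, 1, 9, 0, 1, 0⟩,
   ⟨18, 1, 25, 1, 10, 0, 2, 0⟩,
   ⟨25, 1, 41, 1, 9, 0, 3, 0⟩]

/-- Every window of the chunk passes the extended check `BWin.ok2` (kernel evaluation). -/
theorem bwinsL16_last_ok2 : bwinsL16_last.all BWin.ok2 = true := by decide +kernel

end Summit.KontsevichZagierPeriods.Zeta5Search.RecordRay.BrickAtlas
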